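import Summits.ResolutionOfSingularities.ResolutionOfSingularities.Theses.PAlteration
import Literature.AlgebraicGeometry.Resolution.AlterationsGraphClosure
import Literature.AlgebraicGeometry.Resolution.AlterationsResolution
import Literature.AlgebraicGeometry.Resolution.AlterationsDimension
import Literature.AlgebraicGeometry.Resolution.QuasiProjectiveResolution
import Mathlib.AlgebraicGeometry.Morphisms.UniversallyInjective
import HarnessLib

/-!
# Crux `Pialt` (stmt-ResolutionOfSingularities-0555): the open atom `stub_frobIndet` of the
# line `IndeterminacySplit` follows from a resolution of the CLOSURE OF THE GRAPH — hence holds in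
# dimension `≤ 3` modulo `CossartPiltant2019` and in every dimension modulo `ResolutionInChar p`

Line lead c3 (prover-line-stmt-ResolutionOfSingularities-0555-c3-0, 2026-08-17), `--supports`
stmt-ResolutionOfSingularities-0555; companion of `Theorems/PAlterationPialtAtomsOpenRange.lean`.

`stub_frobIndet` (`Cruxes/Pialt/Lines/IndeterminacySplit.lean`, the hardest stub of the exact
split `Pialt ⇔ FrobIndet ∧ HypersurfacePialt`): for `Y` regular proper integral and `X₁` proper
integral over a perfect field `k` and a `k`-morphism `φ : V → X₁` on a non-empty open `V ⊆ Y`,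
there are a proper surjective `g : Y' → Y` with `Y'` integral regular, finite and universally
injective over a dense open of `Y`, and `ψ : Y' → X₁` over `k` with `ψ = φ ∘ g` on `g⁻¹(V)`.

The classical road (elimination of indeterminacy by a MODIFICATION followed by a resolution):

* `exists_graphClosure` — let `T ⊆ Y ×_k X₁` be the closure of the graph of `φ`
  (de Jong 1996, 4.18–4.19, in tree: `DeJong1996.graphClosure` with `S := Y`, `𝒞 := Y`,
  `X := Y ×_k X₁ → Y`, `U := V`); `T` is integral, `pr₁ : T → Y` is proper and birational and an
  isomorphism over `V`, with the section `V → T` of the graph mapping to `φ` under `pr₂`.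
* `frobIndetAt_of_forall_hasResolution` — if `T` has a resolution of
  singularities `π : Y' → T` (more generally: if every integral scheme proper and birational over
  `Y` has one), then `g := π ≫ pr₁` and `ψ := π ≫ pr₂` do: `g` is proper and birational (hence
  surjective onto the integral `Y`, and an isomorphism — finite and universally injective — over
  a dense open), and on `g⁻¹(V)` the map `π` lands in `pr₁⁻¹(V)`, where `pr₁` is inverted by the
  graph section (`ι_preimage_eq_morphismRestrict_comp_of_section`), so `ψ = φ ∘ g` there.
  Regularity of `Y` and perfectness of `k` are idle.
* `frobIndet_of_dim_le_three` — the registered atom with its binders VERBATIM and the single extra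
  hypothesis `topologicalKrullDim Y ≤ 3`, modulo `CossartPiltant2019`: a scheme proper and
  birational over `Y` is proper over `k` of the same dimension (`dim` is read on the common dense
  open, `topologicalKrullDim_eq_of_isOpenImmersion`). So the atom is OPEN exactly from dimension 4.
* `frobIndet_of_resolutionInChar` — the atom in every dimension modulo `ResolutionInChar p`
  (directly, without the detour `ResolutionInChar ⇒ Pialt ⇒ FrobIndet` of
  `stub_frobIndet_of_pialtOver`).

## References

* A. J. de Jong, *Smoothness, semi-stability and alterations*, Publ. Math. IHÉS 83 (1996),
  4.18–4.21 (the closure of the graph). [DeJong1996]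
* V. Cossart, O. Piltant, J. Algebra 529 (2019), Thm. 1.1. [CossartPiltant2019]
-/

set_option linter.dupNamespace false

noncomputable section

open CategoryTheory CategoryTheory.Limits AlgebraicGeometry TopologicalSpace Order
open Literature.AlgebraicGeometry.Resolution

namespace Summit.ResolutionOfSingularities.ResolutionOfSingularities.Theorems.Pialt.OpenRange

universe u

/-! ## A section over `V` of a morphism that is an isomorphism over `V` inverts it there -/

/-- If `t : T → Y` is an isomorphism over the open `V ⊆ Y` and `σ₀ : V → T` is a section of `t`
over `V` (`σ₀ ≫ t = V ↪ Y`), then the inclusion `t⁻¹(V) ↪ T` is `t|_V` followed by `σ₀`: the lift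
`σ : V → t⁻¹(V)` of `σ₀` is a right inverse, hence THE inverse, of the isomorphism `t|_V`.
[folklore] -/
theorem ι_preimage_eq_morphismRestrict_comp_of_section {T Y : Scheme.{u}} (t : T ⟶ Y)
    (V : Y.Opens) (σ₀ : (V : Scheme.{u}) ⟶ T) (hσ₀ : σ₀ ≫ t = V.ι) [IsIso (t ∣_ V)] :
    (t ⁻¹ᵁ V).ι = (t ∣_ V) ≫ σ₀ := by
  have hr : Set.range σ₀.base ⊆ Set.range (t ⁻¹ᵁ V).ι.base := by
    rintro _ ⟨v, rfl⟩
    rw [Scheme.Opens.range_ι]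
    show (σ₀ ≫ t).base v ∈ V
    rw [hσ₀]
    exact v.2
  let σ : (V : Scheme.{u}) ⟶ (t ⁻¹ᵁ V : T.Opens) := IsOpenImmersion.lift (t ⁻¹ᵁ V).ι σ₀ hr
  have hσ : σ ≫ (t ⁻¹ᵁ V).ι = σ₀ := IsOpenImmersion.lift_fac _ _ _
  have h1 : σ ≫ (t ∣_ V) = 𝟙 _ := by
    rw [← cancel_mono V.ι, Category.assoc, morphismRestrict_ι, ← Category.assoc, hσ, hσ₀,
      Category.id_comp]
  have h2 : (t ∣_ V) ≫ σ = 𝟙 _ := by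
    rw [IsIso.eq_inv_of_inv_hom_id h1, IsIso.hom_inv_id]
  calc (t ⁻¹ᵁ V).ι = ((t ∣_ V) ≫ σ) ≫ (t ⁻¹ᵁ V).ι := by rw [h2, Category.id_comp]
    _ = (t ∣_ V) ≫ σ₀ := by rw [Category.assoc, hσ]

/-! ## The closure of the graph (de Jong 1996, 4.18–4.19, over `S := Y`) -/

/-- **The closure of the graph of a rational map to a proper variety.** For `Y`, `X₁` over a
field `k` with `Y` integral and locally Noetherian, `X₁ → Spec k` proper, and a `k`-morphism
`φ : V → X₁` on a non-empty open `V ⊆ Y`: there are an integral scheme `T` (the closure of the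
graph of `φ` in `Y ×_k X₁`, de Jong 1996, 4.18, in tree `DeJong1996.graphClosure` with `S := Y`,
`𝒞 := Y`), a proper birational `t : T → Y` which is an isomorphism over `V`, a morphism
`s : T → X₁` with `s ≫ f₁ = t ≫ fY`, and a section `σ₀ : V → T` of `t` over `V` (the graph) with
`σ₀ ≫ s = φ`. [cite: DeJong1996, 4.18–4.19, pp. 72–73] -/
theorem exists_graphClosure (k : Type u) [Field k] (Y X₁ : Scheme.{u}) (fY : Y ⟶ Spec (.of k))
    (f₁ : X₁ ⟶ Spec (.of k)) [IsProper f₁] [IsIntegral Y] [IsLocallyNoetherian Y] (V : Y.Opens)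
    (φ : (V : Scheme.{u}) ⟶ X₁) (hV : (V : Set Y).Nonempty) (hφ : V.ι ≫ fY = φ ≫ f₁) :
    ∃ (T : Scheme.{u}) (t : T ⟶ Y) (s : T ⟶ X₁) (σ₀ : (V : Scheme.{u}) ⟶ T),
      IsIntegral T ∧ IsProper t ∧ IsBirational t ∧ IsIso (t ∣_ V) ∧ σ₀ ≫ t = V.ι ∧
        σ₀ ≫ s = φ ∧ s ≫ f₁ = t ≫ fY := by
  haveI : Nonempty V := hV.to_subtype
  -- the graph `γ = (ι, φ) : V → Y ×_k X₁` of `φ`, through the open `pr₁⁻¹(V)`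
  obtain ⟨γ, hγf, hγs⟩ : ∃ γ : (V : Scheme.{u}) ⟶ pullback fY f₁,
      γ ≫ pullback.fst fY f₁ = V.ι ∧ γ ≫ pullback.snd fY f₁ = φ :=
    ⟨pullback.lift V.ι φ hφ, pullback.lift_fst _ _ _, pullback.lift_snd _ _ _⟩
  have hγr : Set.range γ.base ⊆ Set.range (pullback.fst fY f₁ ⁻¹ᵁ V).ι.base := by
    rintro _ ⟨v, rfl⟩
    rw [Scheme.Opens.range_ι]
    show (γ ≫ pullback.fst fY f₁).base v ∈ V
    rw [hγf]
    exact v.2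
  obtain ⟨β, hβγ⟩ : ∃ β : (V : Scheme.{u}) ⟶ (pullback.fst fY f₁ ⁻¹ᵁ V : (pullback fY f₁).Opens),
      β ≫ (pullback.fst fY f₁ ⁻¹ᵁ V).ι = γ :=
    ⟨IsOpenImmersion.lift _ γ hγr, IsOpenImmersion.lift_fac _ _ _⟩
  have hβ : β ≫ (pullback.fst fY f₁ ⁻¹ᵁ V).ι ≫ pullback.fst fY f₁ = ((𝟙 Y) ⁻¹ᵁ V).ι ≫ 𝟙 Y := by
    rw [Category.comp_id, ← Category.assoc, hβγ]; exact hγf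
  -- the closure of the graph
  haveI : IsIntegral (((𝟙 Y) ⁻¹ᵁ V : Y.Opens) : Scheme.{u}) :=
    inferInstanceAs (IsIntegral (V : Scheme.{u}))
  haveI : QuasiCompact (DeJong1996.graphMorphism (pullback.fst fY f₁) (𝟙 Y) V β hβ) :=
    inferInstance
  haveI hT : IsIntegral (DeJong1996.graphClosure (pullback.fst fY f₁) (𝟙 Y) V β hβ) :=
    DeJong1996.isIntegral_graphClosure _ _ _ _ _
  -- the graph as a section `σ₀ : V → T` over `V` (source written as `V = (𝟙 Y)⁻¹(V)`)
  let σ₀ : (V : Scheme.{u}) ⟶ DeJong1996.graphClosure (pullback.fst fY f₁) (𝟙 Y) V β hβ :=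
    DeJong1996.toGraphClosure (pullback.fst fY f₁) (𝟙 Y) V β hβ
  have h1 : σ₀ ≫ DeJong1996.graphClosureSnd (pullback.fst fY f₁) (𝟙 Y) V β hβ =
      β ≫ (pullback.fst fY f₁ ⁻¹ᵁ V).ι :=
    DeJong1996.toGraphClosure_snd _ _ _ _ _
  have h2 : σ₀ ≫ DeJong1996.graphClosureFst (pullback.fst fY f₁) (𝟙 Y) V β hβ = V.ι :=
    DeJong1996.toGraphClosure_fst _ _ _ _ _
  refine ⟨DeJong1996.graphClosure (pullback.fst fY f₁) (𝟙 Y) V β hβ,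
    DeJong1996.graphClosureFst (pullback.fst fY f₁) (𝟙 Y) V β hβ,
    DeJong1996.graphClosureSnd (pullback.fst fY f₁) (𝟙 Y) V β hβ ≫ pullback.snd fY f₁,
    σ₀, hT, inferInstance,
    DeJong1996.isBirational_graphClosureFst (pullback.fst fY f₁) (𝟙 Y) V β hβ hV,
    (DeJong1996.isIso_graphClosureFst_morphismRestrict (pullback.fst fY f₁) (𝟙 Y) V β hβ).1,
    h2, ?_, ?_⟩
  · -- `σ₀ ≫ s = φ`: the graph followed by the second projection is `φ`
    rw [← Category.assoc, h1, hβγ, hγs]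
  · -- `s` is a morphism over `Y → Spec k`
    rw [Category.assoc, ← pullback.condition, ← Category.assoc, DeJong1996.graphClosureSnd_comp,
      Category.assoc, Category.id_comp]

/-! ## `FrobIndet` at `(Y, X₁, V, φ)` from a resolution of the closure of the graph -/

/-- **Elimination of indeterminacy by a modification plus a resolution of the graph closure.**
For `Y`, `X₁` proper integral over a field `k`, a non-empty open `V ⊆ Y` and a `k`-morphism
`φ : V → X₁`: if every integral scheme proper and birational over `Y` has a resolution of
singularities, then there are `g : Y' → Y` proper with `Y'` integral regular, `g` surjective,
finite and universally injective (indeed an isomorphism) over a dense open of `Y`, and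
`ψ : Y' → X₁` over `k` agreeing with `φ ∘ g` on `g⁻¹(V)` — namely `Y' → T → Y` and `Y' → T → X₁`
for `T ⊆ Y ×_k X₁` the closure of the graph of `φ` (`exists_graphClosure`) and `Y' → T` a
resolution. The conclusion is that of the registered atom `stub_frobIndet`; regularity of `Y` is
not needed. [cite: DeJong1996, 4.18–4.19, pp. 72–73] -/
theorem frobIndetAt_of_forall_hasResolution (k : Type u) [Field k] (Y X₁ : Scheme.{u})
    (fY : Y ⟶ Spec (.of k)) (f₁ : X₁ ⟶ Spec (.of k)) [IsProper fY] [IsProper f₁] [IsIntegral Y]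
    (V : Y.Opens) (φ : (V : Scheme.{u}) ⟶ X₁) (hV : (V : Set Y).Nonempty)
    (hφ : V.ι ≫ fY = φ ≫ f₁)
    (hres : ∀ (T : Scheme.{u}) (t : T ⟶ Y), IsProper t → IsIntegral T → IsBirational t →
      Scheme.HasResolution T) :
    ∃ (Y' : Scheme.{u}) (g : Y' ⟶ Y) (ψ : Y' ⟶ X₁), IsProper g ∧ IsIntegral Y' ∧
      Scheme.IsRegular Y' ∧ Function.Surjective g.base ∧
      (∃ V' : Y.Opens, Dense (V' : Set Y) ∧ IsFinite (g ∣_ V') ∧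
        UniversallyInjective (g ∣_ V')) ∧
      ψ ≫ f₁ = g ≫ fY ∧ (g ⁻¹ᵁ V).ι ≫ ψ = (g ∣_ V) ≫ φ := by
  haveI : IsLocallyNoetherian Y := LocallyOfFiniteType.isLocallyNoetherian fY
  obtain ⟨T, t, s, σ₀, hT, hpt, ht, hiso, hσ₀t, hσ₀s, hsf⟩ :=
    exists_graphClosure k Y X₁ fY f₁ V φ hV hφ
  haveI := hT
  haveI := hpt
  haveI := hiso
  -- a resolution of the closure of the graph
  obtain ⟨Y', π, hπ⟩ := hres T t hpt hT ht
  haveI := hπ.isProper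
  haveI : IsReduced Y' := hπ.isRegular.isReduced
  haveI : IsIntegral Y' := hπ.isBirational.isIntegral
  have hg : IsBirational (π ≫ t) := hπ.isBirational.comp ht
  refine ⟨Y', π ≫ t, π ≫ s, inferInstance, inferInstance, hπ.isRegular, ?_, ?_, ?_, ?_⟩
  · -- surjective: proper and dominant onto `Y`
    haveI : IsDominant (π ≫ t) := hg.isDominant
    haveI : Surjective (π ≫ t) := inferInstance
    exact (π ≫ t).surjective
  · -- an isomorphism, hence finite and universally injective, over a dense open
    obtain ⟨U', hU', -, hiso'⟩ := hg
    exact ⟨U', hU', inferInstance, inferInstance⟩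
  · -- `ψ` is a `k`-morphism
    rw [Category.assoc, hsf, Category.assoc]
  · -- `ψ = φ ∘ g` on `g⁻¹(V)`: on `t⁻¹(V)` the section `σ₀` inverts `t`
    have key : (t ⁻¹ᵁ V).ι = (t ∣_ V) ≫ σ₀ :=
      ι_preimage_eq_morphismRestrict_comp_of_section t V σ₀ hσ₀t
    rw [morphismRestrict_comp]
    change (π ⁻¹ᵁ (t ⁻¹ᵁ V)).ι ≫ π ≫ s = ((π ∣_ (t ⁻¹ᵁ V)) ≫ (t ∣_ V)) ≫ φ
    rw [Category.assoc, ← hσ₀s, ← reassoc_of% key, ← morphismRestrict_ι_assoc]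

/-- A scheme proper and birational over an integral scheme `Y` locally of finite type over a
field has the dimension of `Y` (both contain a common non-empty open, over which the morphism is
an isomorphism; `topologicalKrullDim_eq_of_isOpenImmersion`). [folklore] -/
theorem topologicalKrullDim_eq_of_isBirational {k : Type u} [Field k] {T Y : Scheme.{u}}
    [IsIntegral Y] [IsIntegral T] (fY : Y ⟶ Spec (.of k)) [LocallyOfFiniteType fY] (t : T ⟶ Y)
    [LocallyOfFiniteType t] (ht : IsBirational t) :
    topologicalKrullDim T = topologicalKrullDim Y := by
  obtain ⟨U, hU, hU', hiso⟩ := ht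
  haveI : Nonempty U := hU.nonempty.to_subtype
  haveI : Nonempty (t ⁻¹ᵁ U : T.Opens) := hU'.nonempty.to_subtype
  haveI : LocallyOfFiniteType (t ≫ fY) := inferInstance
  rw [← topologicalKrullDim_eq_of_isOpenImmersion (t ≫ fY) (t ⁻¹ᵁ U).ι,
    ← topologicalKrullDim_eq_of_isOpenImmersion fY U.ι]
  -- `t⁻¹(U) ≅ U`
  exact IsHomeomorph.topologicalKrullDim_eq _ (Scheme.homeoOfIso (asIso (t ∣_ U))).isHomeomorph

/-- **`stub_frobIndet` holds in dimension `≤ 3` modulo `CossartPiltant2019`** — the registered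
atom of `Cruxes/Pialt/Lines/IndeterminacySplit.lean` with its binders verbatim and the single
extra hypothesis `topologicalKrullDim Y ≤ 3`: the closure of the graph `T → Y` is proper and
birational, so `T` is a reduced separated scheme of finite type over `k` of dimension `dim Y ≤ 3`
and Cossart–Piltant resolve it; then `frobIndetAt_of_forall_hasResolution`. Regularity of `Y`
and perfectness of `k` are idle. So the atom is OPEN exactly from dimension `4`.
[cite: CossartPiltant2019, Thm. 1.1] -/
theorem frobIndet_of_dim_le_three (hCP : CossartPiltant2019.{0}) (p : ℕ) (_hp : p.Prime)
    (k : Type) [Field k] [CharP k p] [PerfectField k] (Y X₁ : Scheme.{0})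
    (fY : Y ⟶ Spec (.of k)) (f₁ : X₁ ⟶ Spec (.of k)) [IsProper fY] [IsProper f₁] [IsIntegral Y]
    (_hY : Scheme.IsRegular Y) [IsIntegral X₁] (hdim : topologicalKrullDim Y ≤ 3) (V : Y.Opens)
    (φ : (V : Scheme.{0}) ⟶ X₁) (hV : (V : Set Y).Nonempty) (hφ : V.ι ≫ fY = φ ≫ f₁) :
    ∃ (Y' : Scheme.{0}) (g : Y' ⟶ Y) (ψ : Y' ⟶ X₁), IsProper g ∧ IsIntegral Y' ∧
      Scheme.IsRegular Y' ∧ Function.Surjective g.base ∧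
      (∃ V' : Y.Opens, Dense (V' : Set Y) ∧ IsFinite (g ∣_ V') ∧
        UniversallyInjective (g ∣_ V')) ∧
      ψ ≫ f₁ = g ≫ fY ∧ (g ⁻¹ᵁ V).ι ≫ ψ = (g ∣_ V) ≫ φ := by
  refine frobIndetAt_of_forall_hasResolution k Y X₁ fY f₁ V φ hV hφ fun T t ht hT htb => ?_
  haveI := ht; haveI := hT
  haveI : IsProper (t ≫ fY) := inferInstance
  refine hCP k T (t ≫ fY) inferInstance inferInstance inferInstance inferInstance ?_
  rw [topologicalKrullDim_eq_of_isBirational fY t htb]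
  exact hdim

/-- **`stub_frobIndet` in every dimension modulo resolution of singularities in characteristic
`p`** (`ResolutionInChar p`, universe `0`): resolve the closure of the graph. Regularity of `Y`
and perfectness of `k` are idle. [folklore] -/
theorem frobIndet_of_resolutionInChar (p : ℕ) (hR : ResolutionInChar.{0} p) (k : Type) [Field k]
    [CharP k p] (Y X₁ : Scheme.{0}) (fY : Y ⟶ Spec (.of k)) (f₁ : X₁ ⟶ Spec (.of k))
    [IsProper fY] [IsProper f₁] [IsIntegral Y] (V : Y.Opens)
    (φ : (V : Scheme.{0}) ⟶ X₁) (hV : (V : Set Y).Nonempty) (hφ : V.ι ≫ fY = φ ≫ f₁) :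
    ∃ (Y' : Scheme.{0}) (g : Y' ⟶ Y) (ψ : Y' ⟶ X₁), IsProper g ∧ IsIntegral Y' ∧
      Scheme.IsRegular Y' ∧ Function.Surjective g.base ∧
      (∃ V' : Y.Opens, Dense (V' : Set Y) ∧ IsFinite (g ∣_ V') ∧
        UniversallyInjective (g ∣_ V')) ∧
      ψ ≫ f₁ = g ≫ fY ∧ (g ⁻¹ᵁ V).ι ≫ ψ = (g ∣_ V) ≫ φ := by
  refine frobIndetAt_of_forall_hasResolution k Y X₁ fY f₁ V φ hV hφ fun T t ht hT _ => ?_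
  haveI := ht; haveI := hT
  haveI : IsProper (t ≫ fY) := inferInstance
  exact hR k T (t ≫ fY) inferInstance inferInstance inferInstance inferInstance

end Summit.ResolutionOfSingularities.ResolutionOfSingularities.Theorems.Pialt.OpenRange

end
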